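import Literature.AnabelianGeometry.AbsoluteAnabelian.AbsTopIII.ReconstructionCor110ibNaturalFund
import Literature.AnabelianGeometry.AbsoluteAnabelian.AbsTopIII.ReconstructionCor110ibResNaturalProofs
import Literature.AnabelianGeometry.AbsoluteAnabelian.AbsTopIII.ReconstructionCor110iaNaturalFundProofs
import HarnessLib

/-!
# [AbsTopIII] Cor. 1.10 (i)(b) PINNED on THE reciprocity map — closer

Mochizuki, *Topics in Absolute Anabelian Geometry III*, Cor. 1.10 (i)(b) p. 42.  PROOF-ONLY companion
(abc-iut layer L4, abc-iut-L4-d3) of `ReconstructionCor110ibNaturalFund.lean`: the pinned Prop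
`AbsTopIII.Cor_1_10_i_b_natural_fund` ((1♯) `j_k ∘ H¹(i_k^fund)⁻¹ ∘ κ̂ = θ_k` ∧ (2) ∧ (3)) is PROVED by THE family
of abc-iut-L4-d3's `Cor110Nat.exists_family_components` — data `D_k = (exists_torsionReciprocityData_levelChar k).choose`
(which IS `TorsionReciprocityData.fundamental k`, `Cor110iaNat.datum_eq_fundamental`) and completed reciprocity
isomorphisms `e_k` extending the CANONICAL `θ_k` (clause (o)) — with the member
`j_k := H¹(i_k) ≫ (H¹(G_k, Ẑ(1)) ≃ (kˣ)^∧) ≫ e_k`: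
(1♯) `Cor110iiPrime.reciprocityOfContainerIso_eq` + clause (o); (2) `Cor110Nat.reciprocityIso_natural_of_components`;
(3) abc-iut-L4-t11's square `reciprocityIso_galCyclotomeRes` with the restriction-compatibility
`Cor110Open.levelChar_equiv_eq_inducedCyclotomeEquiv`.  Also: the pinned form implies the ∃φ/property-list forms
(`cor_1_10_i_b_natural_of_fund`).  Theorems only; no named fact; no `sorry`.  HONEST FRAMING: classical local class
field theory and Kummer theory; nothing here bears on [IUTchIII] Cor. 3.12 or takes a side.
-/

noncomputable section

open CategoryTheory Function
open Field IsNonarchimedeanLocalField ValuativeRel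
open ProfiniteGrp ProfiniteGrp.ProfiniteCompletion

namespace Literature.AnabelianGeometry.AbsoluteAnabelian

open _root_.TopRep _root_.ContRepresentation _root_.ContinuousCohomology
open Literature.NumberTheory.GaloisRepresentations
open Literature.NumberTheory.GaloisRepresentations.IsNonarchimedeanLocalField
open Literature.NumberTheory.GaloisRepresentations.DiscreteGaloisModule
open Literature.NumberTheory.GaloisRepresentations.LocalWeilDatum

namespace AbsTopIII

/-- **[AbsTopIII] Cor. 1.10 (i)(b) PINNED on THE reciprocity map — PROVED.**  THE family
`j_k := H¹(i_k^fund) ≫ (H¹(G_k, Ẑ(1)) ≃ (kˣ)^∧) ≫ e_k` (THE fundamental datum, `e_k` the completion of THE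
canonical reciprocity map `θ_k`) satisfies (1♯) `j_k ∘ H¹(i_k^fund)⁻¹ ∘ κ̂ = θ_k`, (2) naturality in every
isomorphism of topological groups, (3) the restriction/Verlagerung square along every finite extension.
[cite: MochizukiAbsTopIII2015, Cor 1.10 (i) p.42] [cite: MochizukiAbsAnab2004, Prop 1.2.1 (vi) p.10] -/
theorem cor_1_10_i_b_natural_fund_holds : Cor_1_10_i_b_natural_fund := by
  classical
  obtain ⟨D, e, hD, he, -, hnat⟩ := Cor110Nat.exists_family_components
  -- THE data: `D k` IS `fundamental k` (same `Exists.choose`)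
  have hDk : ∀ (k : Type) [Field k] [ValuativeRel k] [TopologicalSpace k] [IsNonarchimedeanLocalField k]
      [CharZero k], D k = TorsionReciprocityData.fundamental k := fun k _ _ _ _ _ =>
    (hD k).trans (Cor110iaNat.datum_eq_fundamental k)
  refine ⟨fun k _ _ _ _ _ =>
    ((AddEquiv.mk' (continuousCohomologyEquivOfIso
          (galCyclotomeIsoTateModule k (D k).equiv (D k).equiv_smul) 1)
        fun x y => map_add (cohomologyMap (galCyclotomeIsoTateModule k (D k).equiv (D k).equiv_smul).hom 1).hom
          x y).trans
      (continuousCohomologyOneTateModuleEquivCompletion k (Cor110iiPrime.finiteIndex_range_powMonoidHom k))).trans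
      (MulEquiv.toAdditive (e k).toMulEquiv), fun k _ _ _ _ _ _ u => ?_, fun k₁ _ _ _ _ _ k₂ _ _ _ _ _ α x => ?_,
    fun k _ _ _ _ _ k' _ _ _ _ _ _ _ x => ?_⟩
  · -- clause (1♯): transport `fundamental k = D k`, then `j_k ∘ H¹(i_k)⁻¹ ∘ κ̂ = e_k ∘ η = θ_k`
    change reciprocityOfContainerIso (TorsionReciprocityData.fundamental k).equiv_smul
        (((AddEquiv.mk' (continuousCohomologyEquivOfIso
              (galCyclotomeIsoTateModule k (D k).equiv (D k).equiv_smul) 1)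
            fun x y => map_add (cohomologyMap (galCyclotomeIsoTateModule k (D k).equiv
              (D k).equiv_smul).hom 1).hom x y).trans
          (continuousCohomologyOneTateModuleEquivCompletion k
            (Cor110iiPrime.finiteIndex_range_powMonoidHom k))).trans
        (MulEquiv.toAdditive (e k).toMulEquiv)) u = _
    rw [← hDk k,
      Cor110iiPrime.reciprocityOfContainerIso_eq k (Cor110iiPrime.finiteIndex_range_powMonoidHom k)
        (D k).equiv (D k).equiv_smul (e k)]
    exact he k u
  · -- clause (2): naturality in isomorphisms
    exact Cor110Nat.reciprocityIso_natural_of_components D e α (fun ψ hψ hU => hnat k₁ k₂ α ψ hψ hU) x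
  · -- clause (3): the restriction/Verlagerung square (abc-iut-L4-t11), instances discharged
    haveI : ValuativeExtension k k' :=
      valuativeExtension_of_cast_residueFieldCard_eq_zero cast_residueFieldCard_eq_zero_of_algebra
    haveI : ValuativeExtension k k := ⟨fun _ _ => Iff.rfl⟩
    haveI : ValuativeExtension k' k' := ⟨fun _ _ => Iff.rfl⟩
    have hres' : ∀ y : muQZ (absoluteGaloisGroup k'), (D k').equiv y = inducedCyclotomeEquiv k k' (D k).equiv y := by
      intro y
      rw [hD k, hD k']
      exact Cor110Open.levelChar_equiv_eq_inducedCyclotomeEquiv k k' y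
    exact reciprocityIso_galCyclotomeRes k k' (D k).equiv (D k).equiv_smul (D k').equiv (D k').equiv_smul
      (Cor110Nat.coe_equiv_symm_eq_of_compatible _ _ hres') (he k) (he k') x

/-- `Cor_1_10_i_b_natural_fund` — `_holds` alias of `cor_1_10_i_b_natural_fund_holds` above under the fact's exact name (appended
2026-08-28, D-0026 bookkeeping: the proof term is the existing theorem of this file; no statement,
definition or attribute is edited; no new named fact; the ledger's debt table listed the fact
unproved). [cite: MochizukiAbsAnab2004, Prop 1.2.1 (vi) p.10] -/
theorem _root_.Literature.AnabelianGeometry.AbsoluteAnabelian.AbsTopIII.Cor_1_10_i_b_natural_fund_holds :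
    Cor_1_10_i_b_natural_fund :=
  _root_.Literature.AnabelianGeometry.AbsoluteAnabelian.AbsTopIII.cor_1_10_i_b_natural_fund_holds

/-- **The pinned form implies the packaged (∃φ, property-list) form** of `cor_1_10_i_b_resNatural_holds`:
take `φ := (fundamental k).equiv`; `θ_k` IS a local reciprocity map (`isLocalReciprocityMap_levelTheta`).
[cite: MochizukiAbsTopIII2015, Cor 1.10 (i) p.42] -/
theorem cor_1_10_i_b_natural_of_fund (h : Cor_1_10_i_b_natural_fund) :
    ∃ j : ∀ (k : Type) [Field k] [ValuativeRel k] [TopologicalSpace k] [IsNonarchimedeanLocalField k]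
        [CharZero k],
        galCyclotomeH1 (absoluteGaloisGroup k) ≃+ Additive (absoluteGaloisGroupAbelianization k),
      (∀ (k : Type) [Field k] [ValuativeRel k] [TopologicalSpace k] [IsNonarchimedeanLocalField k]
        [CharZero k],
        ∃ (φ : muQZ (absoluteGaloisGroup k) ≃+ Additive (CommGroup.torsion (AlgebraicClosure k)ˣ))
          (hφ : ∀ (σ : absoluteGaloisGroup k) (x : muQZ (absoluteGaloisGroup k)),
            (((Additive.toMul (φ (σ • x)) : CommGroup.torsion (AlgebraicClosure k)ˣ) :
                (AlgebraicClosure k)ˣ) : AlgebraicClosure k) =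
              σ • (((Additive.toMul (φ x) : CommGroup.torsion (AlgebraicClosure k)ˣ) :
                (AlgebraicClosure k)ˣ) : AlgebraicClosure k)),
          IsLocalReciprocityMap k (reciprocityOfContainerIso hφ (j k))) ∧
      (∀ (k₁ : Type) [Field k₁] [ValuativeRel k₁] [TopologicalSpace k₁] [IsNonarchimedeanLocalField k₁]
        [CharZero k₁]
        (k₂ : Type) [Field k₂] [ValuativeRel k₂] [TopologicalSpace k₂] [IsNonarchimedeanLocalField k₂]
        [CharZero k₂]
        (α : absoluteGaloisGroup k₁ ≃ₜ* absoluteGaloisGroup k₂) (x : galCyclotomeH1 (absoluteGaloisGroup k₁)),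
        j k₂ (galCyclotomeH1Map α x) = Additive.ofMul (abelianizationCongr α (Additive.toMul (j k₁ x)))) ∧
      ∀ (k : Type) [Field k] [ValuativeRel k] [TopologicalSpace k] [IsNonarchimedeanLocalField k] [CharZero k]
        (k' : Type) [Field k'] [ValuativeRel k'] [TopologicalSpace k'] [IsNonarchimedeanLocalField k']
        [CharZero k'] [Algebra k k'] [FiniteDimensional k k'] (x : galCyclotomeH1 (absoluteGaloisGroup k)),
        j k' ((galCyclotomeRes k k' 1).hom x) = Additive.ofMul
          (Literature.NumberTheory.GaloisRepresentations.verlagerung k k' (Additive.toMul (j k x))) := by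
  obtain ⟨j, h₁, h₂, h₃⟩ := h
  refine ⟨j, fun k _ _ _ _ _ => ⟨(TorsionReciprocityData.fundamental k).equiv,
    (TorsionReciprocityData.fundamental k).equiv_smul, ?_⟩, h₂, h₃⟩
  haveI : ValuativeExtension k k := ⟨fun _ _ => Iff.rfl⟩
  have heq : reciprocityOfContainerIso (TorsionReciprocityData.fundamental k).equiv_smul (j k) =
      (isReciprocitySystemE (F := k) (E := k) (isClassFieldTheory_localWeilDatum k)).theta :=
    MonoidHom.ext fun u => h₁ k u
  rw [heq]
  exact isLocalReciprocityMap_levelTheta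

/-- **Agreement on the Kummer image**: any two witness families of the pinned Prop take the same values on the
image of `kˣ` (the part (1♯) pins; the Kummer image is a dense copy of `kˣ` in `H¹(G_k, μ_Ẑ(G_k)) ≅ (kˣ)^∧`).
[cite: MochizukiAbsTopIII2015, Cor 1.10 (ii) p.42] -/
theorem Cor_1_10_i_b_natural_fund.eq_on_kummer
    (j j' : ∀ (k : Type) [Field k] [ValuativeRel k] [TopologicalSpace k] [IsNonarchimedeanLocalField k]
      [CharZero k],
      galCyclotomeH1 (absoluteGaloisGroup k) ≃+ Additive (absoluteGaloisGroupAbelianization k))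
    (hj : ∀ (k : Type) [Field k] [ValuativeRel k] [TopologicalSpace k] [IsNonarchimedeanLocalField k]
      [CharZero k] [ValuativeExtension k k] (u : kˣ),
      reciprocityOfContainerIso (TorsionReciprocityData.fundamental k).equiv_smul (j k) u =
        (isReciprocitySystemE (F := k) (E := k) (isClassFieldTheory_localWeilDatum k)).theta u)
    (hj' : ∀ (k : Type) [Field k] [ValuativeRel k] [TopologicalSpace k] [IsNonarchimedeanLocalField k]
      [CharZero k] [ValuativeExtension k k] (u : kˣ),
      reciprocityOfContainerIso (TorsionReciprocityData.fundamental k).equiv_smul (j' k) u =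
        (isReciprocitySystemE (F := k) (E := k) (isClassFieldTheory_localWeilDatum k)).theta u)
    (k : Type) [Field k] [ValuativeRel k] [TopologicalSpace k] [IsNonarchimedeanLocalField k] [CharZero k]
    (u : kˣ) :
    j k (Multiplicative.toAdd (kummerGalCyclotome (TorsionReciprocityData.fundamental k).equiv_smul u)) =
      j' k (Multiplicative.toAdd (kummerGalCyclotome (TorsionReciprocityData.fundamental k).equiv_smul u)) := by
  haveI : ValuativeExtension k k := ⟨fun _ _ => Iff.rfl⟩
  have h := (hj k u).trans (hj' k u).symm
  apply Additive.toMul.injective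
  exact h

end AbsTopIII

end Literature.AnabelianGeometry.AbsoluteAnabelian
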